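import Mathlib
import HarnessLib
import Summits.RiemannHypothesis.RiemannHypothesis.Theorems.IntegerScrewRung128

/-!
# DBR column, rung B-D(a): the zeta screw line is ANTI-PERSISTENT on every certified lattice — `Ψ(2s) < 2Ψ(s)`

RH-FREE certified inequality (LINE 1 of the label discipline: a finite fact about the explicit function
`Ψ = Literature.NumberTheory.LFunctions.zetaScrew`, kernel-checked from the enclosure table of the rung
certificate `IntegerScrewRung128`; it is NOT worded as, and is not, progress toward RH).

Context (HOME `run/shared/lean/pub/rh-dbr/DATA/hm/HM.md`, rh-dbr-eng-2, 2026-08-26): on the arithmetic progression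
`log q^K + k·log r` (`r = p/q`) inside `{log n}`, the increments of Suzuki's screw line `x(log n)`
(`‖x(t) − x(u)‖² = 2Ψ(t − u)`, Suzuki arXiv:2209.04658 p. 2) have the Toeplitz Gram matrix
`c_j(s) = Ψ((j+1)s) − 2Ψ(js) + Ψ((j−1)s)`, `s = log r`; the first reflection coefficient of its Levinson
(= discrete de Branges–Kreĭn = Suzuki arXiv:1308.0228 Thm 1.1) recursion is
`κ₁(s) = −c₁/c₀ = 1 − Ψ(2s)/(2Ψ(s))`. Positive definiteness of the screw matrices (`screwPivot_pos_of_le_128`)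
gives only `|κ₁| < 1`, i.e. `0 < Ψ(2s) < 4Ψ(s)`. The data of record (kit j250190: all 255 certified meshes) show
MORE: `κ₁(s) > 0`, i.e. `Ψ(2s) < 2Ψ(s)` — consecutive lattice increments are negatively correlated. This file
makes that a kernel theorem for every mesh `s = log(p/q)` with `1 ≤ q < p ≤ 11` (`p² ≤ 128`, the range of the
rung-128 enclosure table): `zetaScrew_two_mul_log_lt_two_mul`. As a statement for ALL `s > 0` it is a
conjecture from data (under RH it reads `Σ_γ cos(γs)(1 − cos γs)/γ² < 0`), neither proved RH-free nor an
RH-consequence; nothing here bears on the truth of RH.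

Method [folklore]: from the validated tables of `IntegerScrewRung128` (`light127`, `slope127_eq`,
`utab127_eq`) the kernel enclosure `u(a,b) = Ψ(log(a/b)) − C/4 ∈ ug utab127 a b` (`mem_uR_utab127`, exactly
the hypothesis `hut` inside `quadForm_ge_of_rungW`); the decidable test `apCheck_all`
(`4·(hi u(p²,q²) − 2·lo u(p,q)) < cLoQ·2^48`, `cLoQ ≤ C = ζ(2,¼)`) is decided by the kernel for all 55 pairs
and turned into the real inequality by linear arithmetic. References: M. Suzuki, J. Anal. Math. 136 (2018) =
arXiv:1308.0228, Thm 1.1 [Suzuki2013]; M. Suzuki, J. Lond. Math. Soc. (2) 108 (2023) = arXiv:2206.03682, (1.1)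
[Suzuki2023]; S. M. Rump, Acta Numerica 19 (2010) §10 [folklore].
-/

set_option linter.dupNamespace false

namespace Summit.RiemannHypothesis.RiemannHypothesis.Theorems.DbrLattice

open Literature.NumberTheory.LFunctions Literature.Analysis.ValidatedNumerics
open Literature.Analysis.ValidatedNumerics.Numerics
open Summit.RiemannHypothesis.RiemannHypothesis.Theorems.IntegerScrew
open Summit.RiemannHypothesis.RiemannHypothesis.Theorems.IntegerScrew.RungCert

/-- The kernel enclosure of `u(a,b) = Ψ(log(a/b)) − C/4` read off the rung-128 certificate tables:
`u(a,b) ∈ ug utab127 a b` for `1 ≤ b < a ≤ 128` (the hypothesis `hut` of `quadForm_ge_of_rungW`, extracted).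
[folklore] -/
theorem mem_uR_utab127 {a b : ℕ} (hb : 0 < b) (hba : b < a) (ha : a ≤ 128) :
    FI.mem (uR a b) (ug utab127 a b) := by
  have h := RungCert.light127
  unfold rungLightW at h
  simp only [Bool.and_eq_true, decide_eq_true_eq] at h
  obtain ⟨⟨⟨⟨⟨hlam, hsq⟩, hlogs⟩, hok⟩, _⟩, _⟩ := h
  have hL := logsOK_of_eq hlogs hok
  have hΛ := fun n hn => lamTabOK_sound hlam (n := n) hn
  have hS := fun n hn => mem_of_sqrtTabOK hsq (n := n) hn
  have hAv : FI.mem slopeA slope127 := mem_slopeEncl hL (by omega) RungCert.slope127_eq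
  rw [RungCert.utab127_eq, ug_uTableW hba ha]
  exact mem_uEnclW hΛ hS hL hAv hb hba ha _

/-- The decidable sufficient condition `4·(hi u(p²,q²) − 2·lo u(p,q)) < cLoQ · 2^48` read off the enclosure
table holds for every mesh `log(p/q)`, `1 ≤ q < p ≤ 11` (kernel decision; `cLoQ ≤ C = ζ(2,¼)`). [folklore] -/
theorem apCheck_all : ∀ p < 12, ∀ q < p, 1 ≤ q →
    4 * (((ug utab127 (p ^ 2) (q ^ 2)).hi : ℚ) - 2 * ((ug utab127 p q).lo : ℚ)) < cLoQ * (SC : ℚ) := by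
  decide +kernel

/-- **Anti-persistence of the zeta screw line on every certified lattice** (RH-FREE certified inequality):
`Ψ(log(p²/q²)) < 2·Ψ(log(p/q))` for all `1 ≤ q < p ≤ 11`, i.e. the first reflection coefficient
`κ₁(log(p/q)) = 1 − Ψ(2s)/(2Ψ(s))` of the lattice-sampled screw line is positive. Not implied by `S_M ≻ 0`
(which gives only `Ψ(2s) < 4Ψ(s)`). [folklore] -/
theorem zetaScrew_log_sq_lt_two_mul (p q : ℕ) (hq : 1 ≤ q) (hqp : q < p) (hp : p ≤ 11) :
    zetaScrew (Real.log (((p ^ 2 : ℕ) : ℝ) / ((q ^ 2 : ℕ) : ℝ))) <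
      2 * zetaScrew (Real.log ((p : ℝ) / (q : ℝ))) := by
  have hc := apCheck_all p (by omega) q hqp hq
  have hq2 : 0 < q ^ 2 := by positivity
  have hqp2 : q ^ 2 < p ^ 2 := Nat.pow_lt_pow_left hqp two_ne_zero
  have hp2 : p ^ 2 ≤ 128 := by nlinarith
  obtain ⟨-, h2hi⟩ := mem_uR_utab127 hq2 hqp2 hp2
  obtain ⟨h1lo, -⟩ := mem_uR_utab127 (by omega : 0 < q) hqp (by omega)
  unfold uR at h2hi h1lo
  have hC : ((cLoQ : ℚ) : ℝ) ≤ lerchC := cLoQ_le_lerchC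
  have hSC : (0 : ℝ) < (SC : ℝ) := by norm_num [SC]
  have hc' : (4 : ℝ) * ((((ug utab127 (p ^ 2) (q ^ 2)).hi : ℤ) : ℝ) -
      2 * ((((ug utab127 p q).lo : ℤ) : ℝ))) < ((cLoQ : ℚ) : ℝ) * (SC : ℝ) := by
    exact_mod_cast hc
  have hCS : ((cLoQ : ℚ) : ℝ) * (SC : ℝ) ≤ lerchC * (SC : ℝ) :=
    mul_le_mul_of_nonneg_right hC hSC.le
  refine lt_of_mul_lt_mul_right ?_ hSC.le
  nlinarith

/-- The same inequality written with `2·log(p/q)`: **`Ψ(2s) < 2Ψ(s)` at every mesh `s = log(p/q)`,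
`1 ≤ q < p ≤ 11`** (RH-FREE certified inequality). [folklore] -/
theorem zetaScrew_two_mul_log_lt_two_mul (p q : ℕ) (hq : 1 ≤ q) (hqp : q < p) (hp : p ≤ 11) :
    zetaScrew (2 * Real.log ((p : ℝ) / (q : ℝ))) < 2 * zetaScrew (Real.log ((p : ℝ) / (q : ℝ))) := by
  have h := zetaScrew_log_sq_lt_two_mul p q hq hqp hp
  have hq0 : (0 : ℝ) < q := by exact_mod_cast (show 0 < q by omega)
  have hp0 : (0 : ℝ) < p := by exact_mod_cast (show 0 < p by omega)
  have hlog : Real.log (((p ^ 2 : ℕ) : ℝ) / ((q ^ 2 : ℕ) : ℝ)) = 2 * Real.log ((p : ℝ) / (q : ℝ)) := by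
    push_cast
    rw [← div_pow, Real.log_pow]
    push_cast
    ring
  rwa [hlog] at h

/-- Corollary in `κ₁` form: **`0 < 1 − Ψ(2s)/(2Ψ(s))`** at every mesh `s = log(p/q)`, `1 ≤ q < p ≤ 11` — the
first Levinson / Schur–Suzuki reflection coefficient of the lattice screw line is positive. The hypothesis
`0 < Ψ(s)` holds unconditionally at these meshes (e.g. from the rung certificates `screwPivot_pos_of_le_128`,
`d`-pivots being bounded by `2Ψ`); it is kept explicit to leave this file self-contained. [folklore] -/
theorem kappaOne_pos (p q : ℕ) (hq : 1 ≤ q) (hqp : q < p) (hp : p ≤ 11)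
    (hpos : 0 < zetaScrew (Real.log ((p : ℝ) / (q : ℝ)))) :
    0 < 1 - zetaScrew (2 * Real.log ((p : ℝ) / (q : ℝ))) / (2 * zetaScrew (Real.log ((p : ℝ) / (q : ℝ)))) := by
  have h := zetaScrew_two_mul_log_lt_two_mul p q hq hqp hp
  have h2 : 0 < 2 * zetaScrew (Real.log ((p : ℝ) / (q : ℝ))) := by linarith
  rw [sub_pos, div_lt_one h2]
  exact h

end Summit.RiemannHypothesis.RiemannHypothesis.Theorems.DbrLattice
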